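import Summits.AtomisticToContinuum.HydrodynamicLimit.Theorems.ImplosionDichotomyPolynomialCompressionShadowingDefs

/-!
# Shadowing vocabulary, addendum: higher equation-of-state bounds

Definitions addendum for `stub_logBudgetShadowing` (line `log-lipschitz-budget`, crux `PolynomialCompression`,
stmt-AtomisticToContinuum-12587). Levels `k = 2, 3` of the energy method differentiate the frozen
coefficients `θ(2ζ' + ρζ'')`, `ζ(ρ)` two resp. three more times, so they meet `ζ'''` and `ζ''''` of the
rescaled law `ζ = Z(·σ³)`; like the lower derivatives these are `O(packing)` (analyticity of `Z` at small
packing). `ShadowEosHigher` records the two extra packing-proportional bounds; the level-2/3 contracts take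
it as a hypothesis next to `ShadowSetting`, and the closing file derives it from the low-density data.
-/

noncomputable section

namespace Summit.AtomisticToContinuum.HydrodynamicLimit.Theorems

open Set MeasureTheory
open Literature.MathematicalPhysics.KineticTheory Literature.Analysis.FunctionSpaces

/-- **Higher EOS bounds along the σ-solution**: `|ρ³ ζ'''(ρ)|, |ρ⁴ ζ''''(ρ)| ≤ cZ · ρσ³` on `[0,T) × 𝕋³`.
[folklore] -/
def ShadowEosHigher (cZ σ T : ℝ) (ρ : ℝ → T3 → ℝ) (ζ : ℝ → ℝ) : Prop :=
  ∀ t ∈ Ico 0 T, ∀ x, |ρ t x ^ 3 * deriv (deriv (deriv ζ)) (ρ t x)| ≤ cZ * (ρ t x * σ ^ 3) ∧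
    |ρ t x ^ 4 * deriv (deriv (deriv (deriv ζ))) (ρ t x)| ≤ cZ * (ρ t x * σ ^ 3)

/-- Monotonicity of `ShadowEosHigher` in the constant. [folklore] -/
theorem shadowEosHigher_mono :
    ∀ {cZ cZ' σ T : ℝ} {ρ : ℝ → T3 → ℝ} {ζ : ℝ → ℝ}, ShadowEosHigher cZ σ T ρ ζ → cZ ≤ cZ' → 0 ≤ σ →
      (∀ t ∈ Ico 0 T, ∀ x, 0 ≤ ρ t x) → ShadowEosHigher cZ' σ T ρ ζ := by
  intro cZ cZ' σ T ρ ζ h hc hσ hρ t ht x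
  obtain ⟨h1, h2⟩ := h t ht x
  have hm : cZ * (ρ t x * σ ^ 3) ≤ cZ' * (ρ t x * σ ^ 3) :=
    mul_le_mul_of_nonneg_right hc (mul_nonneg (hρ t ht x) (pow_nonneg hσ 3))
  exact ⟨h1.trans hm, h2.trans hm⟩

end Summit.AtomisticToContinuum.HydrodynamicLimit.Theorems

end
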